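import Summits.ResolutionOfSingularities.ResolutionOfSingularities.Theorems.EquisingularLiftEquisingularLiftNatDegenerateFace
import HarnessLib

/-!
# [OURS · L1 W4.5(b) · EL♮(3) · D-0157 DOOR 1, WIDTH row iso-w3 — «iso specimen pass»] res-L1-w45b-lead-1's (m5) PROBE GERMS A, B, C, D1–D8, E1–E3, G1, G2
# are NOT locally Newton-nondegenerate in the given coordinates (every field)

OURS · L1 W4.5(b) · EL♮(3) stmt-ResolutionOfSingularities-20148 · counted 0 · AI-written (res-L1-w45b-iso-w3 g0, WIDTH TABLE D1′ row iso-w3 fallback «iso specimen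
pass», desk res-L1-w45b-plan-1 g21 2026-08-28T15:19:29Z), weaker than expert review; nothing of [Hironaka2017] asserted; no statement of the manuscript.
Sorry-free, standard axioms, DEF-FREE (every germ is written out in the statement), no instance, no notation.
`--supports stmt-ResolutionOfSingularities-20148 --as helper`.

WHAT. The (m5) probes of `L/res-L1-w45b-lead-1/ND-SPECIMEN-PASS-4.md` 5467ab03a9bcb1c0 §7 and `m5/m5_probe.sage` / `m5_walk2–6.sage` / `walk5_E1-E3_j308885.log` (kit
j307843 … j309578) are lead-1's hand-built NON-ND isolated-surface customers probed against the A‴/A⁗ Def-tower engine of the iso residue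
`stub_elnat_three_isolated_nonDefTowerBQuadPrime`. Each is certified here by the DEGENERATE-FACE CERTIFICATE
`not_isLocallyNewtonNondegenerate_of_split` (…NatDegenerateFace): a positive weight whose initial form is a square `Q²` or `Q₁·Q₂²` with `Q`/`Q₂`
vanishing at an explicit torus point. (G3 = `x⁴ + (xy²+z³)² + y⁹ + y⁷z` is ✓ p642396 `…NatSpecimenG3`.)
HONEST SCOPE. ONE coordinate system per germ: the tree's local datum `LocalND` fails for the polynomial AS WRITTEN; nothing about `IsoHypND`/`IsoHypNDWon` of
the projective surfaces (all charts × origin-fixing automorphisms), nothing about isolatedness (lead-1's Sage over ℚ, candidate), nothing scheme-level.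
Dim-3 char-p resolution is a theorem in print (Cossart–Piltant 2008/2009); this is OUR kernel-own census bookkeeping, counted 0.
-/

noncomputable section

set_option linter.dupNamespace false

open MvPolynomial

namespace Summit.ResolutionOfSingularities.ResolutionOfSingularities.Cruxes.EquisingularLiftNat.Sections

variable {k : Type} [Field k]

/-- Transport of a weighted-homogeneity statement along an equality of weights. [OURS · small print] -/
theorem isWeightedHomogeneous_of_eq {N : ℕ} {w : Fin N → ℤ} {φ : MvPolynomial (Fin N) k} {m m' : ℤ} (h : IsWeightedHomogeneous w φ m)
    (e : m = m') : IsWeightedHomogeneous w φ m' := e ▸ h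

/-- **(m5) probe A** `(x³−y⁵)² + x⁵y² + y⁷z + z⁸` (ND-SPECIMEN-PASS-4 §7 (A)): weight `(5,3,10)` cuts the edge `{x⁶, x³y⁵, y¹⁰}` (weight 30; the rest 31, 31, 80), initial form `(x³−y⁵)²`, singular at the torus point `(1,1,1)`. [OURS · L1 W4.5b · germ-level certificate] -/
theorem not_isLocallyNewtonNondegenerate_m5A :
    ¬ IsLocallyNewtonNondegenerate ((X 0 ^ 3 - X 1 ^ 5) ^ 2 + X 0 ^ 5 * X 1 ^ 2 + X 1 ^ 7 * X 2 + X 2 ^ 8 : MvPolynomial (Fin 3) k) := by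
  have hX : ∀ i : Fin 3, IsWeightedHomogeneous ![(5 : ℤ), 3, 10] (X i : MvPolynomial (Fin 3) k) (![(5 : ℤ), 3, 10] i) :=
    fun i => isWeightedHomogeneous_X k _ i
  have hP : IsWeightedHomogeneous ![(5 : ℤ), 3, 10] ((X 0 ^ 3 - X 1 ^ 5) ^ 2 : MvPolynomial (Fin 3) k) 30 :=
    isWeightedHomogeneous_of_eq ((isWeightedHomogeneous_sub (isWeightedHomogeneous_of_eq ((hX 0).pow 3) (show _ = (15 : ℤ) by simp)) (isWeightedHomogeneous_of_eq ((hX 1).pow 5) (show _ = (15 : ℤ) by simp))).pow 2) (by simp)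
  have hR : ∀ d, coeff d (X 0 ^ 5 * X 1 ^ 2 + X 1 ^ 7 * X 2 + X 2 ^ 8 : MvPolynomial (Fin 3) k) ≠ 0 → (30 : ℤ) < Finsupp.weight ![(5 : ℤ), 3, 10] d :=
    (lt_weight_add (lt_weight_add (lt_weight_of_isWeightedHomogeneous (isWeightedHomogeneous_of_eq (((hX 0).pow 5).mul ((hX 1).pow 2)) (show _ = (31 : ℤ) by simp)) (by norm_num : (30 : ℤ) < 31)) (lt_weight_of_isWeightedHomogeneous (isWeightedHomogeneous_of_eq (((hX 1).pow 7).mul (hX 2)) (show _ = (31 : ℤ) by simp)) (by norm_num : (30 : ℤ) < 31))) (lt_weight_of_isWeightedHomogeneous (isWeightedHomogeneous_of_eq ((hX 2).pow 8) (show _ = (80 : ℤ) by simp)) (by norm_num : (30 : ℤ) < 80)))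
  have hF : ((X 0 ^ 3 - X 1 ^ 5) ^ 2 + X 0 ^ 5 * X 1 ^ 2 + X 1 ^ 7 * X 2 + X 2 ^ 8 : MvPolynomial (Fin 3) k) = (X 0 ^ 3 - X 1 ^ 5) ^ 2 + (X 0 ^ 5 * X 1 ^ 2 + X 1 ^ 7 * X 2 + X 2 ^ 8) := by ring
  have hP0 : ((X 0 ^ 3 - X 1 ^ 5) ^ 2 : MvPolynomial (Fin 3) k) ≠ 0 := ne_zero_of_eval_ne_zero ![(1 : k), 0, 0] (by simp)
  have hQ : eval ![(1 : k), 1, 1] ((X 0 ^ 3 - X 1 ^ 5) : MvPolynomial (Fin 3) k) = 0 := by simp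
  exact not_isLocallyNewtonNondegenerate_of_split ![(5 : ℤ), 3, 10] (by decide) hF hP hR hP0 ![(1 : k), 1, 1]
    (fun i => by fin_cases i <;> simp) (by rw [map_pow, hQ]; norm_num) (fun i => eval_pderiv_sq_eq_zero _ _ hQ i)

/-- **(m5) probe B** `(x³−y⁵)² + x⁵y² + y⁸z + z⁹`: weight `(5,3,10)`, edge `{x⁶, x³y⁵, y¹⁰}` (30; rest 31, 34, 90), initial form `(x³−y⁵)²`, torus point `(1,1,1)`. [OURS · L1 W4.5b] -/
theorem not_isLocallyNewtonNondegenerate_m5B :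
    ¬ IsLocallyNewtonNondegenerate ((X 0 ^ 3 - X 1 ^ 5) ^ 2 + X 0 ^ 5 * X 1 ^ 2 + X 1 ^ 8 * X 2 + X 2 ^ 9 : MvPolynomial (Fin 3) k) := by
  have hX : ∀ i : Fin 3, IsWeightedHomogeneous ![(5 : ℤ), 3, 10] (X i : MvPolynomial (Fin 3) k) (![(5 : ℤ), 3, 10] i) :=
    fun i => isWeightedHomogeneous_X k _ i
  have hP : IsWeightedHomogeneous ![(5 : ℤ), 3, 10] ((X 0 ^ 3 - X 1 ^ 5) ^ 2 : MvPolynomial (Fin 3) k) 30 :=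
    isWeightedHomogeneous_of_eq ((isWeightedHomogeneous_sub (isWeightedHomogeneous_of_eq ((hX 0).pow 3) (show _ = (15 : ℤ) by simp)) (isWeightedHomogeneous_of_eq ((hX 1).pow 5) (show _ = (15 : ℤ) by simp))).pow 2) (by simp)
  have hR : ∀ d, coeff d (X 0 ^ 5 * X 1 ^ 2 + X 1 ^ 8 * X 2 + X 2 ^ 9 : MvPolynomial (Fin 3) k) ≠ 0 → (30 : ℤ) < Finsupp.weight ![(5 : ℤ), 3, 10] d :=
    (lt_weight_add (lt_weight_add (lt_weight_of_isWeightedHomogeneous (isWeightedHomogeneous_of_eq (((hX 0).pow 5).mul ((hX 1).pow 2)) (show _ = (31 : ℤ) by simp)) (by norm_num : (30 : ℤ) < 31)) (lt_weight_of_isWeightedHomogeneous (isWeightedHomogeneous_of_eq (((hX 1).pow 8).mul (hX 2)) (show _ = (34 : ℤ) by simp)) (by norm_num : (30 : ℤ) < 34))) (lt_weight_of_isWeightedHomogeneous (isWeightedHomogeneous_of_eq ((hX 2).pow 9) (show _ = (90 : ℤ) by simp)) (by norm_num : (30 : ℤ) < 90)))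
  have hF : ((X 0 ^ 3 - X 1 ^ 5) ^ 2 + X 0 ^ 5 * X 1 ^ 2 + X 1 ^ 8 * X 2 + X 2 ^ 9 : MvPolynomial (Fin 3) k) = (X 0 ^ 3 - X 1 ^ 5) ^ 2 + (X 0 ^ 5 * X 1 ^ 2 + X 1 ^ 8 * X 2 + X 2 ^ 9) := by ring
  have hP0 : ((X 0 ^ 3 - X 1 ^ 5) ^ 2 : MvPolynomial (Fin 3) k) ≠ 0 := ne_zero_of_eval_ne_zero ![(1 : k), 0, 0] (by simp)
  have hQ : eval ![(1 : k), 1, 1] ((X 0 ^ 3 - X 1 ^ 5) : MvPolynomial (Fin 3) k) = 0 := by simp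
  exact not_isLocallyNewtonNondegenerate_of_split ![(5 : ℤ), 3, 10] (by decide) hF hP hR hP0 ![(1 : k), 1, 1]
    (fun i => by fin_cases i <;> simp) (by rw [map_pow, hQ]; norm_num) (fun i => eval_pderiv_sq_eq_zero _ _ hQ i)

/-- **(m5) probe C** `(x²−y³)² + x³y²z + y⁵z² + z⁷`: weight `(3,2,2)`, edge `{x⁴, x²y³, y⁶}` (12; rest 15, 14, 14), initial form `(x²−y³)²`, torus point `(1,1,1)`. [OURS · L1 W4.5b] -/
theorem not_isLocallyNewtonNondegenerate_m5C :
    ¬ IsLocallyNewtonNondegenerate ((X 0 ^ 2 - X 1 ^ 3) ^ 2 + X 0 ^ 3 * X 1 ^ 2 * X 2 + X 1 ^ 5 * X 2 ^ 2 + X 2 ^ 7 : MvPolynomial (Fin 3) k) := by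
  have hX : ∀ i : Fin 3, IsWeightedHomogeneous ![(3 : ℤ), 2, 2] (X i : MvPolynomial (Fin 3) k) (![(3 : ℤ), 2, 2] i) :=
    fun i => isWeightedHomogeneous_X k _ i
  have hP : IsWeightedHomogeneous ![(3 : ℤ), 2, 2] ((X 0 ^ 2 - X 1 ^ 3) ^ 2 : MvPolynomial (Fin 3) k) 12 :=
    isWeightedHomogeneous_of_eq ((isWeightedHomogeneous_sub (isWeightedHomogeneous_of_eq ((hX 0).pow 2) (show _ = (6 : ℤ) by simp)) (isWeightedHomogeneous_of_eq ((hX 1).pow 3) (show _ = (6 : ℤ) by simp))).pow 2) (by simp)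
  have hR : ∀ d, coeff d (X 0 ^ 3 * X 1 ^ 2 * X 2 + X 1 ^ 5 * X 2 ^ 2 + X 2 ^ 7 : MvPolynomial (Fin 3) k) ≠ 0 → (12 : ℤ) < Finsupp.weight ![(3 : ℤ), 2, 2] d :=
    (lt_weight_add (lt_weight_add (lt_weight_of_isWeightedHomogeneous (isWeightedHomogeneous_of_eq ((((hX 0).pow 3).mul ((hX 1).pow 2)).mul (hX 2)) (show _ = (15 : ℤ) by simp)) (by norm_num : (12 : ℤ) < 15)) (lt_weight_of_isWeightedHomogeneous (isWeightedHomogeneous_of_eq (((hX 1).pow 5).mul ((hX 2).pow 2)) (show _ = (14 : ℤ) by simp)) (by norm_num : (12 : ℤ) < 14))) (lt_weight_of_isWeightedHomogeneous (isWeightedHomogeneous_of_eq ((hX 2).pow 7) (show _ = (14 : ℤ) by simp)) (by norm_num : (12 : ℤ) < 14)))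
  have hF : ((X 0 ^ 2 - X 1 ^ 3) ^ 2 + X 0 ^ 3 * X 1 ^ 2 * X 2 + X 1 ^ 5 * X 2 ^ 2 + X 2 ^ 7 : MvPolynomial (Fin 3) k) = (X 0 ^ 2 - X 1 ^ 3) ^ 2 + (X 0 ^ 3 * X 1 ^ 2 * X 2 + X 1 ^ 5 * X 2 ^ 2 + X 2 ^ 7) := by ring
  have hP0 : ((X 0 ^ 2 - X 1 ^ 3) ^ 2 : MvPolynomial (Fin 3) k) ≠ 0 := ne_zero_of_eval_ne_zero ![(1 : k), 0, 0] (by simp)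
  have hQ : eval ![(1 : k), 1, 1] ((X 0 ^ 2 - X 1 ^ 3) : MvPolynomial (Fin 3) k) = 0 := by simp
  exact not_isLocallyNewtonNondegenerate_of_split ![(3 : ℤ), 2, 2] (by decide) hF hP hR hP0 ![(1 : k), 1, 1]
    (fun i => by fin_cases i <;> simp) (by rw [map_pow, hQ]; norm_num) (fun i => eval_pderiv_sq_eq_zero _ _ hQ i)

/-- **(m5) probe D1** `x⁶ + y⁵(x−z)² + xy⁴z² + y¹¹` (walk2): weight `(3,2,3)`, face part `y⁵(x−z)²` (16; rest 18, 17, 22), torus point `(1,1,1)` (`x = z`). [OURS · L1 W4.5b] -/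
theorem not_isLocallyNewtonNondegenerate_m5D1 :
    ¬ IsLocallyNewtonNondegenerate (X 0 ^ 6 + X 1 ^ 5 * (X 0 - X 2) ^ 2 + X 0 * X 1 ^ 4 * X 2 ^ 2 + X 1 ^ 11 : MvPolynomial (Fin 3) k) := by
  have hX : ∀ i : Fin 3, IsWeightedHomogeneous ![(3 : ℤ), 2, 3] (X i : MvPolynomial (Fin 3) k) (![(3 : ℤ), 2, 3] i) :=
    fun i => isWeightedHomogeneous_X k _ i
  have hP : IsWeightedHomogeneous ![(3 : ℤ), 2, 3] (X 1 ^ 5 * (X 0 - X 2) ^ 2 : MvPolynomial (Fin 3) k) 16 :=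
    isWeightedHomogeneous_of_eq ((isWeightedHomogeneous_of_eq ((hX 1).pow 5) (show _ = (10 : ℤ) by simp)).mul ((isWeightedHomogeneous_sub (isWeightedHomogeneous_of_eq (hX 0) (show _ = (3 : ℤ) by simp)) (isWeightedHomogeneous_of_eq (hX 2) (show _ = (3 : ℤ) by simp))).pow 2)) (by simp)
  have hR : ∀ d, coeff d (X 0 ^ 6 + X 0 * X 1 ^ 4 * X 2 ^ 2 + X 1 ^ 11 : MvPolynomial (Fin 3) k) ≠ 0 → (16 : ℤ) < Finsupp.weight ![(3 : ℤ), 2, 3] d :=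
    (lt_weight_add (lt_weight_add (lt_weight_of_isWeightedHomogeneous (isWeightedHomogeneous_of_eq ((hX 0).pow 6) (show _ = (18 : ℤ) by simp)) (by norm_num : (16 : ℤ) < 18)) (lt_weight_of_isWeightedHomogeneous (isWeightedHomogeneous_of_eq (((hX 0).mul ((hX 1).pow 4)).mul ((hX 2).pow 2)) (show _ = (17 : ℤ) by simp)) (by norm_num : (16 : ℤ) < 17))) (lt_weight_of_isWeightedHomogeneous (isWeightedHomogeneous_of_eq ((hX 1).pow 11) (show _ = (22 : ℤ) by simp)) (by norm_num : (16 : ℤ) < 22)))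
  have hF : (X 0 ^ 6 + X 1 ^ 5 * (X 0 - X 2) ^ 2 + X 0 * X 1 ^ 4 * X 2 ^ 2 + X 1 ^ 11 : MvPolynomial (Fin 3) k) = X 1 ^ 5 * (X 0 - X 2) ^ 2 + (X 0 ^ 6 + X 0 * X 1 ^ 4 * X 2 ^ 2 + X 1 ^ 11) := by ring
  have hP0 : (X 1 ^ 5 * (X 0 - X 2) ^ 2 : MvPolynomial (Fin 3) k) ≠ 0 := ne_zero_of_eval_ne_zero ![(1 : k), 1, 0] (by simp)
  have hQ : eval ![(1 : k), 1, 1] ((X 0 - X 2) : MvPolynomial (Fin 3) k) = 0 := by simp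
  exact not_isLocallyNewtonNondegenerate_of_split ![(3 : ℤ), 2, 3] (by decide) hF hP hR hP0 ![(1 : k), 1, 1]
    (fun i => by fin_cases i <;> simp) (eval_mul_sq_eq_zero _ _ _ hQ) (fun i => eval_pderiv_mul_sq_eq_zero _ _ _ hQ i)

/-- **(m5) probe D2** `x⁶ + y⁵(x−z)² + xy⁴z² + y⁹z + z¹²` (walk2): weight `(3,2,3)`, face part `y⁵(x−z)²` (16; rest 18, 17, 21, 36), torus point `(1,1,1)`. [OURS · L1 W4.5b] -/
theorem not_isLocallyNewtonNondegenerate_m5D2 :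
    ¬ IsLocallyNewtonNondegenerate (X 0 ^ 6 + X 1 ^ 5 * (X 0 - X 2) ^ 2 + X 0 * X 1 ^ 4 * X 2 ^ 2 + X 1 ^ 9 * X 2 + X 2 ^ 12 : MvPolynomial (Fin 3) k) := by
  have hX : ∀ i : Fin 3, IsWeightedHomogeneous ![(3 : ℤ), 2, 3] (X i : MvPolynomial (Fin 3) k) (![(3 : ℤ), 2, 3] i) :=
    fun i => isWeightedHomogeneous_X k _ i
  have hP : IsWeightedHomogeneous ![(3 : ℤ), 2, 3] (X 1 ^ 5 * (X 0 - X 2) ^ 2 : MvPolynomial (Fin 3) k) 16 :=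
    isWeightedHomogeneous_of_eq ((isWeightedHomogeneous_of_eq ((hX 1).pow 5) (show _ = (10 : ℤ) by simp)).mul ((isWeightedHomogeneous_sub (isWeightedHomogeneous_of_eq (hX 0) (show _ = (3 : ℤ) by simp)) (isWeightedHomogeneous_of_eq (hX 2) (show _ = (3 : ℤ) by simp))).pow 2)) (by simp)
  have hR : ∀ d, coeff d (X 0 ^ 6 + X 0 * X 1 ^ 4 * X 2 ^ 2 + X 1 ^ 9 * X 2 + X 2 ^ 12 : MvPolynomial (Fin 3) k) ≠ 0 → (16 : ℤ) < Finsupp.weight ![(3 : ℤ), 2, 3] d :=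
    (lt_weight_add (lt_weight_add (lt_weight_add (lt_weight_of_isWeightedHomogeneous (isWeightedHomogeneous_of_eq ((hX 0).pow 6) (show _ = (18 : ℤ) by simp)) (by norm_num : (16 : ℤ) < 18)) (lt_weight_of_isWeightedHomogeneous (isWeightedHomogeneous_of_eq (((hX 0).mul ((hX 1).pow 4)).mul ((hX 2).pow 2)) (show _ = (17 : ℤ) by simp)) (by norm_num : (16 : ℤ) < 17))) (lt_weight_of_isWeightedHomogeneous (isWeightedHomogeneous_of_eq (((hX 1).pow 9).mul (hX 2)) (show _ = (21 : ℤ) by simp)) (by norm_num : (16 : ℤ) < 21))) (lt_weight_of_isWeightedHomogeneous (isWeightedHomogeneous_of_eq ((hX 2).pow 12) (show _ = (36 : ℤ) by simp)) (by norm_num : (16 : ℤ) < 36)))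
  have hF : (X 0 ^ 6 + X 1 ^ 5 * (X 0 - X 2) ^ 2 + X 0 * X 1 ^ 4 * X 2 ^ 2 + X 1 ^ 9 * X 2 + X 2 ^ 12 : MvPolynomial (Fin 3) k) = X 1 ^ 5 * (X 0 - X 2) ^ 2 + (X 0 ^ 6 + X 0 * X 1 ^ 4 * X 2 ^ 2 + X 1 ^ 9 * X 2 + X 2 ^ 12) := by ring
  have hP0 : (X 1 ^ 5 * (X 0 - X 2) ^ 2 : MvPolynomial (Fin 3) k) ≠ 0 := ne_zero_of_eval_ne_zero ![(1 : k), 1, 0] (by simp)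
  have hQ : eval ![(1 : k), 1, 1] ((X 0 - X 2) : MvPolynomial (Fin 3) k) = 0 := by simp
  exact not_isLocallyNewtonNondegenerate_of_split ![(3 : ℤ), 2, 3] (by decide) hF hP hR hP0 ![(1 : k), 1, 1]
    (fun i => by fin_cases i <;> simp) (eval_mul_sq_eq_zero _ _ _ hQ) (fun i => eval_pderiv_mul_sq_eq_zero _ _ _ hQ i)

/-- **(m5) probe D3** `x⁶ + y⁵(x−z)² + x²y³z² + y¹¹ + z¹²` (walk2; lead-1: «not an escape»): weight `(3,2,3)`, face part `y⁵(x−z)²` (16; rest 18, 18, 22, 36), torus point `(1,1,1)`. [OURS · L1 W4.5b] -/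
theorem not_isLocallyNewtonNondegenerate_m5D3 :
    ¬ IsLocallyNewtonNondegenerate (X 0 ^ 6 + X 1 ^ 5 * (X 0 - X 2) ^ 2 + X 0 ^ 2 * X 1 ^ 3 * X 2 ^ 2 + X 1 ^ 11 + X 2 ^ 12 : MvPolynomial (Fin 3) k) := by
  have hX : ∀ i : Fin 3, IsWeightedHomogeneous ![(3 : ℤ), 2, 3] (X i : MvPolynomial (Fin 3) k) (![(3 : ℤ), 2, 3] i) :=
    fun i => isWeightedHomogeneous_X k _ i
  have hP : IsWeightedHomogeneous ![(3 : ℤ), 2, 3] (X 1 ^ 5 * (X 0 - X 2) ^ 2 : MvPolynomial (Fin 3) k) 16 :=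
    isWeightedHomogeneous_of_eq ((isWeightedHomogeneous_of_eq ((hX 1).pow 5) (show _ = (10 : ℤ) by simp)).mul ((isWeightedHomogeneous_sub (isWeightedHomogeneous_of_eq (hX 0) (show _ = (3 : ℤ) by simp)) (isWeightedHomogeneous_of_eq (hX 2) (show _ = (3 : ℤ) by simp))).pow 2)) (by simp)
  have hR : ∀ d, coeff d (X 0 ^ 6 + X 0 ^ 2 * X 1 ^ 3 * X 2 ^ 2 + X 1 ^ 11 + X 2 ^ 12 : MvPolynomial (Fin 3) k) ≠ 0 → (16 : ℤ) < Finsupp.weight ![(3 : ℤ), 2, 3] d :=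
    (lt_weight_add (lt_weight_add (lt_weight_add (lt_weight_of_isWeightedHomogeneous (isWeightedHomogeneous_of_eq ((hX 0).pow 6) (show _ = (18 : ℤ) by simp)) (by norm_num : (16 : ℤ) < 18)) (lt_weight_of_isWeightedHomogeneous (isWeightedHomogeneous_of_eq ((((hX 0).pow 2).mul ((hX 1).pow 3)).mul ((hX 2).pow 2)) (show _ = (18 : ℤ) by simp)) (by norm_num : (16 : ℤ) < 18))) (lt_weight_of_isWeightedHomogeneous (isWeightedHomogeneous_of_eq ((hX 1).pow 11) (show _ = (22 : ℤ) by simp)) (by norm_num : (16 : ℤ) < 22))) (lt_weight_of_isWeightedHomogeneous (isWeightedHomogeneous_of_eq ((hX 2).pow 12) (show _ = (36 : ℤ) by simp)) (by norm_num : (16 : ℤ) < 36)))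
  have hF : (X 0 ^ 6 + X 1 ^ 5 * (X 0 - X 2) ^ 2 + X 0 ^ 2 * X 1 ^ 3 * X 2 ^ 2 + X 1 ^ 11 + X 2 ^ 12 : MvPolynomial (Fin 3) k) = X 1 ^ 5 * (X 0 - X 2) ^ 2 + (X 0 ^ 6 + X 0 ^ 2 * X 1 ^ 3 * X 2 ^ 2 + X 1 ^ 11 + X 2 ^ 12) := by ring
  have hP0 : (X 1 ^ 5 * (X 0 - X 2) ^ 2 : MvPolynomial (Fin 3) k) ≠ 0 := ne_zero_of_eval_ne_zero ![(1 : k), 1, 0] (by simp)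
  have hQ : eval ![(1 : k), 1, 1] ((X 0 - X 2) : MvPolynomial (Fin 3) k) = 0 := by simp
  exact not_isLocallyNewtonNondegenerate_of_split ![(3 : ℤ), 2, 3] (by decide) hF hP hR hP0 ![(1 : k), 1, 1]
    (fun i => by fin_cases i <;> simp) (eval_mul_sq_eq_zero _ _ _ hQ) (fun i => eval_pderiv_mul_sq_eq_zero _ _ _ hQ i)

/-- **(m5) probe D4** `x⁶ + z·y³(x+y²)² + z⁸ + y¹¹` (walk3; lead-1: INSIDE B via the k = 0 branch): weight `(2,1,2)`, face part `zy³(x+y²)²` (9; rest 12, 16, 11), torus point `(−1,1,1)` (`x + y² = 0`). [OURS · L1 W4.5b] -/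
theorem not_isLocallyNewtonNondegenerate_m5D4 :
    ¬ IsLocallyNewtonNondegenerate (X 0 ^ 6 + X 2 * X 1 ^ 3 * (X 0 + X 1 ^ 2) ^ 2 + X 2 ^ 8 + X 1 ^ 11 : MvPolynomial (Fin 3) k) := by
  have hX : ∀ i : Fin 3, IsWeightedHomogeneous ![(2 : ℤ), 1, 2] (X i : MvPolynomial (Fin 3) k) (![(2 : ℤ), 1, 2] i) :=
    fun i => isWeightedHomogeneous_X k _ i
  have hP : IsWeightedHomogeneous ![(2 : ℤ), 1, 2] (X 2 * X 1 ^ 3 * (X 0 + X 1 ^ 2) ^ 2 : MvPolynomial (Fin 3) k) 9 :=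
    isWeightedHomogeneous_of_eq ((isWeightedHomogeneous_of_eq ((hX 2).mul ((hX 1).pow 3)) (show _ = (5 : ℤ) by simp)).mul (((isWeightedHomogeneous_of_eq (hX 0) (show _ = (2 : ℤ) by simp)).add (isWeightedHomogeneous_of_eq ((hX 1).pow 2) (show _ = (2 : ℤ) by simp))).pow 2)) (by simp)
  have hR : ∀ d, coeff d (X 0 ^ 6 + X 2 ^ 8 + X 1 ^ 11 : MvPolynomial (Fin 3) k) ≠ 0 → (9 : ℤ) < Finsupp.weight ![(2 : ℤ), 1, 2] d :=
    (lt_weight_add (lt_weight_add (lt_weight_of_isWeightedHomogeneous (isWeightedHomogeneous_of_eq ((hX 0).pow 6) (show _ = (12 : ℤ) by simp)) (by norm_num : (9 : ℤ) < 12)) (lt_weight_of_isWeightedHomogeneous (isWeightedHomogeneous_of_eq ((hX 2).pow 8) (show _ = (16 : ℤ) by simp)) (by norm_num : (9 : ℤ) < 16))) (lt_weight_of_isWeightedHomogeneous (isWeightedHomogeneous_of_eq ((hX 1).pow 11) (show _ = (11 : ℤ) by simp)) (by norm_num : (9 : ℤ) < 11)))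
  have hF : (X 0 ^ 6 + X 2 * X 1 ^ 3 * (X 0 + X 1 ^ 2) ^ 2 + X 2 ^ 8 + X 1 ^ 11 : MvPolynomial (Fin 3) k) = X 2 * X 1 ^ 3 * (X 0 + X 1 ^ 2) ^ 2 + (X 0 ^ 6 + X 2 ^ 8 + X 1 ^ 11) := by ring
  have hP0 : (X 2 * X 1 ^ 3 * (X 0 + X 1 ^ 2) ^ 2 : MvPolynomial (Fin 3) k) ≠ 0 := ne_zero_of_eval_ne_zero ![(0 : k), 1, 1] (by simp)
  have hQ : eval ![(-1 : k), 1, 1] ((X 0 + X 1 ^ 2) : MvPolynomial (Fin 3) k) = 0 := by simp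
  exact not_isLocallyNewtonNondegenerate_of_split ![(2 : ℤ), 1, 2] (by decide) hF hP hR hP0 ![(-1 : k), 1, 1]
    (fun i => by fin_cases i <;> simp) (eval_mul_sq_eq_zero _ _ _ hQ) (fun i => eval_pderiv_mul_sq_eq_zero _ _ _ hQ i)

/-- **(m5) probe D5** `x⁶ + z·y³(x+y²)² + xy⁴z³ + z⁸ + y¹¹` (walk3): weight `(2,1,2)`, face part `zy³(x+y²)²` (9; rest 12, 12, 16, 11), torus point `(−1,1,1)`. [OURS · L1 W4.5b] -/
theorem not_isLocallyNewtonNondegenerate_m5D5 :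
    ¬ IsLocallyNewtonNondegenerate (X 0 ^ 6 + X 2 * X 1 ^ 3 * (X 0 + X 1 ^ 2) ^ 2 + X 0 * X 1 ^ 4 * X 2 ^ 3 + X 2 ^ 8 + X 1 ^ 11 : MvPolynomial (Fin 3) k) := by
  have hX : ∀ i : Fin 3, IsWeightedHomogeneous ![(2 : ℤ), 1, 2] (X i : MvPolynomial (Fin 3) k) (![(2 : ℤ), 1, 2] i) :=
    fun i => isWeightedHomogeneous_X k _ i
  have hP : IsWeightedHomogeneous ![(2 : ℤ), 1, 2] (X 2 * X 1 ^ 3 * (X 0 + X 1 ^ 2) ^ 2 : MvPolynomial (Fin 3) k) 9 :=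
    isWeightedHomogeneous_of_eq ((isWeightedHomogeneous_of_eq ((hX 2).mul ((hX 1).pow 3)) (show _ = (5 : ℤ) by simp)).mul (((isWeightedHomogeneous_of_eq (hX 0) (show _ = (2 : ℤ) by simp)).add (isWeightedHomogeneous_of_eq ((hX 1).pow 2) (show _ = (2 : ℤ) by simp))).pow 2)) (by simp)
  have hR : ∀ d, coeff d (X 0 ^ 6 + X 0 * X 1 ^ 4 * X 2 ^ 3 + X 2 ^ 8 + X 1 ^ 11 : MvPolynomial (Fin 3) k) ≠ 0 → (9 : ℤ) < Finsupp.weight ![(2 : ℤ), 1, 2] d :=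
    (lt_weight_add (lt_weight_add (lt_weight_add (lt_weight_of_isWeightedHomogeneous (isWeightedHomogeneous_of_eq ((hX 0).pow 6) (show _ = (12 : ℤ) by simp)) (by norm_num : (9 : ℤ) < 12)) (lt_weight_of_isWeightedHomogeneous (isWeightedHomogeneous_of_eq (((hX 0).mul ((hX 1).pow 4)).mul ((hX 2).pow 3)) (show _ = (12 : ℤ) by simp)) (by norm_num : (9 : ℤ) < 12))) (lt_weight_of_isWeightedHomogeneous (isWeightedHomogeneous_of_eq ((hX 2).pow 8) (show _ = (16 : ℤ) by simp)) (by norm_num : (9 : ℤ) < 16))) (lt_weight_of_isWeightedHomogeneous (isWeightedHomogeneous_of_eq ((hX 1).pow 11) (show _ = (11 : ℤ) by simp)) (by norm_num : (9 : ℤ) < 11)))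
  have hF : (X 0 ^ 6 + X 2 * X 1 ^ 3 * (X 0 + X 1 ^ 2) ^ 2 + X 0 * X 1 ^ 4 * X 2 ^ 3 + X 2 ^ 8 + X 1 ^ 11 : MvPolynomial (Fin 3) k) = X 2 * X 1 ^ 3 * (X 0 + X 1 ^ 2) ^ 2 + (X 0 ^ 6 + X 0 * X 1 ^ 4 * X 2 ^ 3 + X 2 ^ 8 + X 1 ^ 11) := by ring
  have hP0 : (X 2 * X 1 ^ 3 * (X 0 + X 1 ^ 2) ^ 2 : MvPolynomial (Fin 3) k) ≠ 0 := ne_zero_of_eval_ne_zero ![(0 : k), 1, 1] (by simp)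
  have hQ : eval ![(-1 : k), 1, 1] ((X 0 + X 1 ^ 2) : MvPolynomial (Fin 3) k) = 0 := by simp
  exact not_isLocallyNewtonNondegenerate_of_split ![(2 : ℤ), 1, 2] (by decide) hF hP hR hP0 ![(-1 : k), 1, 1]
    (fun i => by fin_cases i <;> simp) (eval_mul_sq_eq_zero _ _ _ hQ) (fun i => eval_pderiv_mul_sq_eq_zero _ _ _ hQ i)

/-- **(m5) probe D6** `x⁶ + z·y³(x+y²)² + z⁹ + y¹³ + x²y⁵z` (walk3): weight `(2,1,2)`, face part `zy³(x+y²)²` (9; rest 12, 18, 13, 11), torus point `(−1,1,1)`. [OURS · L1 W4.5b] -/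
theorem not_isLocallyNewtonNondegenerate_m5D6 :
    ¬ IsLocallyNewtonNondegenerate (X 0 ^ 6 + X 2 * X 1 ^ 3 * (X 0 + X 1 ^ 2) ^ 2 + X 2 ^ 9 + X 1 ^ 13 + X 0 ^ 2 * X 1 ^ 5 * X 2 : MvPolynomial (Fin 3) k) := by
  have hX : ∀ i : Fin 3, IsWeightedHomogeneous ![(2 : ℤ), 1, 2] (X i : MvPolynomial (Fin 3) k) (![(2 : ℤ), 1, 2] i) :=
    fun i => isWeightedHomogeneous_X k _ i
  have hP : IsWeightedHomogeneous ![(2 : ℤ), 1, 2] (X 2 * X 1 ^ 3 * (X 0 + X 1 ^ 2) ^ 2 : MvPolynomial (Fin 3) k) 9 :=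
    isWeightedHomogeneous_of_eq ((isWeightedHomogeneous_of_eq ((hX 2).mul ((hX 1).pow 3)) (show _ = (5 : ℤ) by simp)).mul (((isWeightedHomogeneous_of_eq (hX 0) (show _ = (2 : ℤ) by simp)).add (isWeightedHomogeneous_of_eq ((hX 1).pow 2) (show _ = (2 : ℤ) by simp))).pow 2)) (by simp)
  have hR : ∀ d, coeff d (X 0 ^ 6 + X 2 ^ 9 + X 1 ^ 13 + X 0 ^ 2 * X 1 ^ 5 * X 2 : MvPolynomial (Fin 3) k) ≠ 0 → (9 : ℤ) < Finsupp.weight ![(2 : ℤ), 1, 2] d :=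
    (lt_weight_add (lt_weight_add (lt_weight_add (lt_weight_of_isWeightedHomogeneous (isWeightedHomogeneous_of_eq ((hX 0).pow 6) (show _ = (12 : ℤ) by simp)) (by norm_num : (9 : ℤ) < 12)) (lt_weight_of_isWeightedHomogeneous (isWeightedHomogeneous_of_eq ((hX 2).pow 9) (show _ = (18 : ℤ) by simp)) (by norm_num : (9 : ℤ) < 18))) (lt_weight_of_isWeightedHomogeneous (isWeightedHomogeneous_of_eq ((hX 1).pow 13) (show _ = (13 : ℤ) by simp)) (by norm_num : (9 : ℤ) < 13))) (lt_weight_of_isWeightedHomogeneous (isWeightedHomogeneous_of_eq ((((hX 0).pow 2).mul ((hX 1).pow 5)).mul (hX 2)) (show _ = (11 : ℤ) by simp)) (by norm_num : (9 : ℤ) < 11)))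
  have hF : (X 0 ^ 6 + X 2 * X 1 ^ 3 * (X 0 + X 1 ^ 2) ^ 2 + X 2 ^ 9 + X 1 ^ 13 + X 0 ^ 2 * X 1 ^ 5 * X 2 : MvPolynomial (Fin 3) k) = X 2 * X 1 ^ 3 * (X 0 + X 1 ^ 2) ^ 2 + (X 0 ^ 6 + X 2 ^ 9 + X 1 ^ 13 + X 0 ^ 2 * X 1 ^ 5 * X 2) := by ring
  have hP0 : (X 2 * X 1 ^ 3 * (X 0 + X 1 ^ 2) ^ 2 : MvPolynomial (Fin 3) k) ≠ 0 := ne_zero_of_eval_ne_zero ![(0 : k), 1, 1] (by simp)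
  have hQ : eval ![(-1 : k), 1, 1] ((X 0 + X 1 ^ 2) : MvPolynomial (Fin 3) k) = 0 := by simp
  exact not_isLocallyNewtonNondegenerate_of_split ![(2 : ℤ), 1, 2] (by decide) hF hP hR hP0 ![(-1 : k), 1, 1]
    (fun i => by fin_cases i <;> simp) (eval_mul_sq_eq_zero _ _ _ hQ) (fun i => eval_pderiv_mul_sq_eq_zero _ _ _ hQ i)

/-- **(m5) probe D7** `x⁶ + z·y³(x+y²)² + z¹⁰ + y¹¹` (walk4; lead-1: INSIDE A, 3 moves): weight `(2,1,2)`, face part `zy³(x+y²)²` (9; rest 12, 20, 11), torus point `(−1,1,1)`. [OURS · L1 W4.5b] -/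
theorem not_isLocallyNewtonNondegenerate_m5D7 :
    ¬ IsLocallyNewtonNondegenerate (X 0 ^ 6 + X 2 * X 1 ^ 3 * (X 0 + X 1 ^ 2) ^ 2 + X 2 ^ 10 + X 1 ^ 11 : MvPolynomial (Fin 3) k) := by
  have hX : ∀ i : Fin 3, IsWeightedHomogeneous ![(2 : ℤ), 1, 2] (X i : MvPolynomial (Fin 3) k) (![(2 : ℤ), 1, 2] i) :=
    fun i => isWeightedHomogeneous_X k _ i
  have hP : IsWeightedHomogeneous ![(2 : ℤ), 1, 2] (X 2 * X 1 ^ 3 * (X 0 + X 1 ^ 2) ^ 2 : MvPolynomial (Fin 3) k) 9 :=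
    isWeightedHomogeneous_of_eq ((isWeightedHomogeneous_of_eq ((hX 2).mul ((hX 1).pow 3)) (show _ = (5 : ℤ) by simp)).mul (((isWeightedHomogeneous_of_eq (hX 0) (show _ = (2 : ℤ) by simp)).add (isWeightedHomogeneous_of_eq ((hX 1).pow 2) (show _ = (2 : ℤ) by simp))).pow 2)) (by simp)
  have hR : ∀ d, coeff d (X 0 ^ 6 + X 2 ^ 10 + X 1 ^ 11 : MvPolynomial (Fin 3) k) ≠ 0 → (9 : ℤ) < Finsupp.weight ![(2 : ℤ), 1, 2] d :=
    (lt_weight_add (lt_weight_add (lt_weight_of_isWeightedHomogeneous (isWeightedHomogeneous_of_eq ((hX 0).pow 6) (show _ = (12 : ℤ) by simp)) (by norm_num : (9 : ℤ) < 12)) (lt_weight_of_isWeightedHomogeneous (isWeightedHomogeneous_of_eq ((hX 2).pow 10) (show _ = (20 : ℤ) by simp)) (by norm_num : (9 : ℤ) < 20))) (lt_weight_of_isWeightedHomogeneous (isWeightedHomogeneous_of_eq ((hX 1).pow 11) (show _ = (11 : ℤ) by simp)) (by norm_num : (9 : ℤ) < 11)))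
  have hF : (X 0 ^ 6 + X 2 * X 1 ^ 3 * (X 0 + X 1 ^ 2) ^ 2 + X 2 ^ 10 + X 1 ^ 11 : MvPolynomial (Fin 3) k) = X 2 * X 1 ^ 3 * (X 0 + X 1 ^ 2) ^ 2 + (X 0 ^ 6 + X 2 ^ 10 + X 1 ^ 11) := by ring
  have hP0 : (X 2 * X 1 ^ 3 * (X 0 + X 1 ^ 2) ^ 2 : MvPolynomial (Fin 3) k) ≠ 0 := ne_zero_of_eval_ne_zero ![(0 : k), 1, 1] (by simp)
  have hQ : eval ![(-1 : k), 1, 1] ((X 0 + X 1 ^ 2) : MvPolynomial (Fin 3) k) = 0 := by simp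
  exact not_isLocallyNewtonNondegenerate_of_split ![(2 : ℤ), 1, 2] (by decide) hF hP hR hP0 ![(-1 : k), 1, 1]
    (fun i => by fin_cases i <;> simp) (eval_mul_sq_eq_zero _ _ _ hQ) (fun i => eval_pderiv_mul_sq_eq_zero _ _ _ hQ i)

/-- **(m5) probe D8** `x⁶ + z·y³(x+y²)² + z¹⁰ + y¹³ + xy⁸` (walk4): weight `(2,1,2)`, face part `zy³(x+y²)²` (9; rest 12, 20, 13, 10), torus point `(−1,1,1)`. [OURS · L1 W4.5b] -/
theorem not_isLocallyNewtonNondegenerate_m5D8 :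
    ¬ IsLocallyNewtonNondegenerate (X 0 ^ 6 + X 2 * X 1 ^ 3 * (X 0 + X 1 ^ 2) ^ 2 + X 2 ^ 10 + X 1 ^ 13 + X 0 * X 1 ^ 8 : MvPolynomial (Fin 3) k) := by
  have hX : ∀ i : Fin 3, IsWeightedHomogeneous ![(2 : ℤ), 1, 2] (X i : MvPolynomial (Fin 3) k) (![(2 : ℤ), 1, 2] i) :=
    fun i => isWeightedHomogeneous_X k _ i
  have hP : IsWeightedHomogeneous ![(2 : ℤ), 1, 2] (X 2 * X 1 ^ 3 * (X 0 + X 1 ^ 2) ^ 2 : MvPolynomial (Fin 3) k) 9 :=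
    isWeightedHomogeneous_of_eq ((isWeightedHomogeneous_of_eq ((hX 2).mul ((hX 1).pow 3)) (show _ = (5 : ℤ) by simp)).mul (((isWeightedHomogeneous_of_eq (hX 0) (show _ = (2 : ℤ) by simp)).add (isWeightedHomogeneous_of_eq ((hX 1).pow 2) (show _ = (2 : ℤ) by simp))).pow 2)) (by simp)
  have hR : ∀ d, coeff d (X 0 ^ 6 + X 2 ^ 10 + X 1 ^ 13 + X 0 * X 1 ^ 8 : MvPolynomial (Fin 3) k) ≠ 0 → (9 : ℤ) < Finsupp.weight ![(2 : ℤ), 1, 2] d :=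
    (lt_weight_add (lt_weight_add (lt_weight_add (lt_weight_of_isWeightedHomogeneous (isWeightedHomogeneous_of_eq ((hX 0).pow 6) (show _ = (12 : ℤ) by simp)) (by norm_num : (9 : ℤ) < 12)) (lt_weight_of_isWeightedHomogeneous (isWeightedHomogeneous_of_eq ((hX 2).pow 10) (show _ = (20 : ℤ) by simp)) (by norm_num : (9 : ℤ) < 20))) (lt_weight_of_isWeightedHomogeneous (isWeightedHomogeneous_of_eq ((hX 1).pow 13) (show _ = (13 : ℤ) by simp)) (by norm_num : (9 : ℤ) < 13))) (lt_weight_of_isWeightedHomogeneous (isWeightedHomogeneous_of_eq ((hX 0).mul ((hX 1).pow 8)) (show _ = (10 : ℤ) by simp)) (by norm_num : (9 : ℤ) < 10)))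
  have hF : (X 0 ^ 6 + X 2 * X 1 ^ 3 * (X 0 + X 1 ^ 2) ^ 2 + X 2 ^ 10 + X 1 ^ 13 + X 0 * X 1 ^ 8 : MvPolynomial (Fin 3) k) = X 2 * X 1 ^ 3 * (X 0 + X 1 ^ 2) ^ 2 + (X 0 ^ 6 + X 2 ^ 10 + X 1 ^ 13 + X 0 * X 1 ^ 8) := by ring
  have hP0 : (X 2 * X 1 ^ 3 * (X 0 + X 1 ^ 2) ^ 2 : MvPolynomial (Fin 3) k) ≠ 0 := ne_zero_of_eval_ne_zero ![(0 : k), 1, 1] (by simp)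
  have hQ : eval ![(-1 : k), 1, 1] ((X 0 + X 1 ^ 2) : MvPolynomial (Fin 3) k) = 0 := by simp
  exact not_isLocallyNewtonNondegenerate_of_split ![(2 : ℤ), 1, 2] (by decide) hF hP hR hP0 ![(-1 : k), 1, 1]
    (fun i => by fin_cases i <;> simp) (eval_mul_sq_eq_zero _ _ _ hQ) (fun i => eval_pderiv_mul_sq_eq_zero _ _ _ hQ i)

/-- **(m5) probe G1** `x⁴ + (xy + z³)² + y⁷` (walk6): weight `(2,1,1)`, edge `{x²y², xyz³, z⁶}` (6; rest 8, 7), initial form `(xy+z³)²`, torus point `(−1,1,1)`. [OURS · L1 W4.5b] -/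
theorem not_isLocallyNewtonNondegenerate_m5G1 :
    ¬ IsLocallyNewtonNondegenerate (X 0 ^ 4 + (X 0 * X 1 + X 2 ^ 3) ^ 2 + X 1 ^ 7 : MvPolynomial (Fin 3) k) := by
  have hX : ∀ i : Fin 3, IsWeightedHomogeneous ![(2 : ℤ), 1, 1] (X i : MvPolynomial (Fin 3) k) (![(2 : ℤ), 1, 1] i) :=
    fun i => isWeightedHomogeneous_X k _ i
  have hP : IsWeightedHomogeneous ![(2 : ℤ), 1, 1] ((X 0 * X 1 + X 2 ^ 3) ^ 2 : MvPolynomial (Fin 3) k) 6 :=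
    isWeightedHomogeneous_of_eq (((isWeightedHomogeneous_of_eq ((hX 0).mul (hX 1)) (show _ = (3 : ℤ) by simp)).add (isWeightedHomogeneous_of_eq ((hX 2).pow 3) (show _ = (3 : ℤ) by simp))).pow 2) (by simp)
  have hR : ∀ d, coeff d (X 0 ^ 4 + X 1 ^ 7 : MvPolynomial (Fin 3) k) ≠ 0 → (6 : ℤ) < Finsupp.weight ![(2 : ℤ), 1, 1] d :=
    (lt_weight_add (lt_weight_of_isWeightedHomogeneous (isWeightedHomogeneous_of_eq ((hX 0).pow 4) (show _ = (8 : ℤ) by simp)) (by norm_num : (6 : ℤ) < 8)) (lt_weight_of_isWeightedHomogeneous (isWeightedHomogeneous_of_eq ((hX 1).pow 7) (show _ = (7 : ℤ) by simp)) (by norm_num : (6 : ℤ) < 7)))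
  have hF : (X 0 ^ 4 + (X 0 * X 1 + X 2 ^ 3) ^ 2 + X 1 ^ 7 : MvPolynomial (Fin 3) k) = (X 0 * X 1 + X 2 ^ 3) ^ 2 + (X 0 ^ 4 + X 1 ^ 7) := by ring
  have hP0 : ((X 0 * X 1 + X 2 ^ 3) ^ 2 : MvPolynomial (Fin 3) k) ≠ 0 := ne_zero_of_eval_ne_zero ![(0 : k), 0, 1] (by simp)
  have hQ : eval ![(-1 : k), 1, 1] ((X 0 * X 1 + X 2 ^ 3) : MvPolynomial (Fin 3) k) = 0 := by simp
  exact not_isLocallyNewtonNondegenerate_of_split ![(2 : ℤ), 1, 1] (by decide) hF hP hR hP0 ![(-1 : k), 1, 1]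
    (fun i => by fin_cases i <;> simp) (by rw [map_pow, hQ]; norm_num) (fun i => eval_pderiv_sq_eq_zero _ _ hQ i)

/-- **(m5) probe G2** `x⁴ + (xy + z³)² + y⁷ + xz⁵` (walk6): weight `(2,1,1)`, edge `{x²y², xyz³, z⁶}` (6; rest 8, 7, 7), initial form `(xy+z³)²`, torus point `(−1,1,1)`. [OURS · L1 W4.5b] -/
theorem not_isLocallyNewtonNondegenerate_m5G2 :
    ¬ IsLocallyNewtonNondegenerate (X 0 ^ 4 + (X 0 * X 1 + X 2 ^ 3) ^ 2 + X 1 ^ 7 + X 0 * X 2 ^ 5 : MvPolynomial (Fin 3) k) := by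
  have hX : ∀ i : Fin 3, IsWeightedHomogeneous ![(2 : ℤ), 1, 1] (X i : MvPolynomial (Fin 3) k) (![(2 : ℤ), 1, 1] i) :=
    fun i => isWeightedHomogeneous_X k _ i
  have hP : IsWeightedHomogeneous ![(2 : ℤ), 1, 1] ((X 0 * X 1 + X 2 ^ 3) ^ 2 : MvPolynomial (Fin 3) k) 6 :=
    isWeightedHomogeneous_of_eq (((isWeightedHomogeneous_of_eq ((hX 0).mul (hX 1)) (show _ = (3 : ℤ) by simp)).add (isWeightedHomogeneous_of_eq ((hX 2).pow 3) (show _ = (3 : ℤ) by simp))).pow 2) (by simp)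
  have hR : ∀ d, coeff d (X 0 ^ 4 + X 1 ^ 7 + X 0 * X 2 ^ 5 : MvPolynomial (Fin 3) k) ≠ 0 → (6 : ℤ) < Finsupp.weight ![(2 : ℤ), 1, 1] d :=
    (lt_weight_add (lt_weight_add (lt_weight_of_isWeightedHomogeneous (isWeightedHomogeneous_of_eq ((hX 0).pow 4) (show _ = (8 : ℤ) by simp)) (by norm_num : (6 : ℤ) < 8)) (lt_weight_of_isWeightedHomogeneous (isWeightedHomogeneous_of_eq ((hX 1).pow 7) (show _ = (7 : ℤ) by simp)) (by norm_num : (6 : ℤ) < 7))) (lt_weight_of_isWeightedHomogeneous (isWeightedHomogeneous_of_eq ((hX 0).mul ((hX 2).pow 5)) (show _ = (7 : ℤ) by simp)) (by norm_num : (6 : ℤ) < 7)))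
  have hF : (X 0 ^ 4 + (X 0 * X 1 + X 2 ^ 3) ^ 2 + X 1 ^ 7 + X 0 * X 2 ^ 5 : MvPolynomial (Fin 3) k) = (X 0 * X 1 + X 2 ^ 3) ^ 2 + (X 0 ^ 4 + X 1 ^ 7 + X 0 * X 2 ^ 5) := by ring
  have hP0 : ((X 0 * X 1 + X 2 ^ 3) ^ 2 : MvPolynomial (Fin 3) k) ≠ 0 := ne_zero_of_eval_ne_zero ![(0 : k), 0, 1] (by simp)
  have hQ : eval ![(-1 : k), 1, 1] ((X 0 * X 1 + X 2 ^ 3) : MvPolynomial (Fin 3) k) = 0 := by simp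
  exact not_isLocallyNewtonNondegenerate_of_split ![(2 : ℤ), 1, 1] (by decide) hF hP hR hP0 ![(-1 : k), 1, 1]
    (fun i => by fin_cases i <;> simp) (by rw [map_pow, hQ]; norm_num) (fun i => eval_pderiv_sq_eq_zero _ _ hQ i)

/-- **(m5) probe E1** `x⁴ + x²z² + 2xz⁴ + z⁶ + y⁶ = x⁴ + (xz + z³)² + y⁶` (walk5): weight `(2,2,1)`, edge `{x²z², xz⁴, z⁶}` (6; rest 8, 12), initial form `(xz+z³)²`, torus point `(−1,1,1)`. [OURS · L1 W4.5b] -/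
theorem not_isLocallyNewtonNondegenerate_m5E1 :
    ¬ IsLocallyNewtonNondegenerate (X 1 ^ 6 + X 2 ^ 6 + 2 * X 0 * X 2 ^ 4 + X 0 ^ 4 + X 0 ^ 2 * X 2 ^ 2 : MvPolynomial (Fin 3) k) := by
  have hX : ∀ i : Fin 3, IsWeightedHomogeneous ![(2 : ℤ), 2, 1] (X i : MvPolynomial (Fin 3) k) (![(2 : ℤ), 2, 1] i) :=
    fun i => isWeightedHomogeneous_X k _ i
  have hP : IsWeightedHomogeneous ![(2 : ℤ), 2, 1] ((X 0 * X 2 + X 2 ^ 3) ^ 2 : MvPolynomial (Fin 3) k) 6 :=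
    isWeightedHomogeneous_of_eq (((isWeightedHomogeneous_of_eq ((hX 0).mul (hX 2)) (show _ = (3 : ℤ) by simp)).add (isWeightedHomogeneous_of_eq ((hX 2).pow 3) (show _ = (3 : ℤ) by simp))).pow 2) (by simp)
  have hR : ∀ d, coeff d (X 0 ^ 4 + X 1 ^ 6 : MvPolynomial (Fin 3) k) ≠ 0 → (6 : ℤ) < Finsupp.weight ![(2 : ℤ), 2, 1] d :=
    (lt_weight_add (lt_weight_of_isWeightedHomogeneous (isWeightedHomogeneous_of_eq ((hX 0).pow 4) (show _ = (8 : ℤ) by simp)) (by norm_num : (6 : ℤ) < 8)) (lt_weight_of_isWeightedHomogeneous (isWeightedHomogeneous_of_eq ((hX 1).pow 6) (show _ = (12 : ℤ) by simp)) (by norm_num : (6 : ℤ) < 12)))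
  have hF : (X 1 ^ 6 + X 2 ^ 6 + 2 * X 0 * X 2 ^ 4 + X 0 ^ 4 + X 0 ^ 2 * X 2 ^ 2 : MvPolynomial (Fin 3) k) = (X 0 * X 2 + X 2 ^ 3) ^ 2 + (X 0 ^ 4 + X 1 ^ 6) := by ring
  have hP0 : ((X 0 * X 2 + X 2 ^ 3) ^ 2 : MvPolynomial (Fin 3) k) ≠ 0 := ne_zero_of_eval_ne_zero ![(0 : k), 0, 1] (by simp)
  have hQ : eval ![(-1 : k), 1, 1] ((X 0 * X 2 + X 2 ^ 3) : MvPolynomial (Fin 3) k) = 0 := by simp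
  exact not_isLocallyNewtonNondegenerate_of_split ![(2 : ℤ), 2, 1] (by decide) hF hP hR hP0 ![(-1 : k), 1, 1]
    (fun i => by fin_cases i <;> simp) (by rw [map_pow, hQ]; norm_num) (fun i => eval_pderiv_sq_eq_zero _ _ hQ i)

/-- **(m5) probe E2** `E1 + xy⁴` (walk5): weight `(2,2,1)`, same edge (6; rest 8, 12, 10), initial form `(xz+z³)²`, torus point `(−1,1,1)`. [OURS · L1 W4.5b] -/
theorem not_isLocallyNewtonNondegenerate_m5E2 :
    ¬ IsLocallyNewtonNondegenerate (X 1 ^ 6 + X 2 ^ 6 + X 0 * X 1 ^ 4 + 2 * X 0 * X 2 ^ 4 + X 0 ^ 4 + X 0 ^ 2 * X 2 ^ 2 : MvPolynomial (Fin 3) k) := by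
  have hX : ∀ i : Fin 3, IsWeightedHomogeneous ![(2 : ℤ), 2, 1] (X i : MvPolynomial (Fin 3) k) (![(2 : ℤ), 2, 1] i) :=
    fun i => isWeightedHomogeneous_X k _ i
  have hP : IsWeightedHomogeneous ![(2 : ℤ), 2, 1] ((X 0 * X 2 + X 2 ^ 3) ^ 2 : MvPolynomial (Fin 3) k) 6 :=
    isWeightedHomogeneous_of_eq (((isWeightedHomogeneous_of_eq ((hX 0).mul (hX 2)) (show _ = (3 : ℤ) by simp)).add (isWeightedHomogeneous_of_eq ((hX 2).pow 3) (show _ = (3 : ℤ) by simp))).pow 2) (by simp)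
  have hR : ∀ d, coeff d (X 0 ^ 4 + X 1 ^ 6 + X 0 * X 1 ^ 4 : MvPolynomial (Fin 3) k) ≠ 0 → (6 : ℤ) < Finsupp.weight ![(2 : ℤ), 2, 1] d :=
    (lt_weight_add (lt_weight_add (lt_weight_of_isWeightedHomogeneous (isWeightedHomogeneous_of_eq ((hX 0).pow 4) (show _ = (8 : ℤ) by simp)) (by norm_num : (6 : ℤ) < 8)) (lt_weight_of_isWeightedHomogeneous (isWeightedHomogeneous_of_eq ((hX 1).pow 6) (show _ = (12 : ℤ) by simp)) (by norm_num : (6 : ℤ) < 12))) (lt_weight_of_isWeightedHomogeneous (isWeightedHomogeneous_of_eq ((hX 0).mul ((hX 1).pow 4)) (show _ = (10 : ℤ) by simp)) (by norm_num : (6 : ℤ) < 10)))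
  have hF : (X 1 ^ 6 + X 2 ^ 6 + X 0 * X 1 ^ 4 + 2 * X 0 * X 2 ^ 4 + X 0 ^ 4 + X 0 ^ 2 * X 2 ^ 2 : MvPolynomial (Fin 3) k) = (X 0 * X 2 + X 2 ^ 3) ^ 2 + (X 0 ^ 4 + X 1 ^ 6 + X 0 * X 1 ^ 4) := by ring
  have hP0 : ((X 0 * X 2 + X 2 ^ 3) ^ 2 : MvPolynomial (Fin 3) k) ≠ 0 := ne_zero_of_eval_ne_zero ![(0 : k), 0, 1] (by simp)
  have hQ : eval ![(-1 : k), 1, 1] ((X 0 * X 2 + X 2 ^ 3) : MvPolynomial (Fin 3) k) = 0 := by simp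
  exact not_isLocallyNewtonNondegenerate_of_split ![(2 : ℤ), 2, 1] (by decide) hF hP hR hP0 ![(-1 : k), 1, 1]
    (fun i => by fin_cases i <;> simp) (by rw [map_pow, hQ]; norm_num) (fun i => eval_pderiv_sq_eq_zero _ _ hQ i)

/-- **(m5) probe E3** `E1 + y⁴z³` (walk5): weight `(2,2,1)`, same edge (6; rest 8, 12, 11), initial form `(xz+z³)²`, torus point `(−1,1,1)`. [OURS · L1 W4.5b] -/
theorem not_isLocallyNewtonNondegenerate_m5E3 :
    ¬ IsLocallyNewtonNondegenerate (X 1 ^ 4 * X 2 ^ 3 + X 1 ^ 6 + X 2 ^ 6 + 2 * X 0 * X 2 ^ 4 + X 0 ^ 4 + X 0 ^ 2 * X 2 ^ 2 : MvPolynomial (Fin 3) k) := by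
  have hX : ∀ i : Fin 3, IsWeightedHomogeneous ![(2 : ℤ), 2, 1] (X i : MvPolynomial (Fin 3) k) (![(2 : ℤ), 2, 1] i) :=
    fun i => isWeightedHomogeneous_X k _ i
  have hP : IsWeightedHomogeneous ![(2 : ℤ), 2, 1] ((X 0 * X 2 + X 2 ^ 3) ^ 2 : MvPolynomial (Fin 3) k) 6 :=
    isWeightedHomogeneous_of_eq (((isWeightedHomogeneous_of_eq ((hX 0).mul (hX 2)) (show _ = (3 : ℤ) by simp)).add (isWeightedHomogeneous_of_eq ((hX 2).pow 3) (show _ = (3 : ℤ) by simp))).pow 2) (by simp)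
  have hR : ∀ d, coeff d (X 0 ^ 4 + X 1 ^ 6 + X 1 ^ 4 * X 2 ^ 3 : MvPolynomial (Fin 3) k) ≠ 0 → (6 : ℤ) < Finsupp.weight ![(2 : ℤ), 2, 1] d :=
    (lt_weight_add (lt_weight_add (lt_weight_of_isWeightedHomogeneous (isWeightedHomogeneous_of_eq ((hX 0).pow 4) (show _ = (8 : ℤ) by simp)) (by norm_num : (6 : ℤ) < 8)) (lt_weight_of_isWeightedHomogeneous (isWeightedHomogeneous_of_eq ((hX 1).pow 6) (show _ = (12 : ℤ) by simp)) (by norm_num : (6 : ℤ) < 12))) (lt_weight_of_isWeightedHomogeneous (isWeightedHomogeneous_of_eq (((hX 1).pow 4).mul ((hX 2).pow 3)) (show _ = (11 : ℤ) by simp)) (by norm_num : (6 : ℤ) < 11)))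
  have hF : (X 1 ^ 4 * X 2 ^ 3 + X 1 ^ 6 + X 2 ^ 6 + 2 * X 0 * X 2 ^ 4 + X 0 ^ 4 + X 0 ^ 2 * X 2 ^ 2 : MvPolynomial (Fin 3) k) = (X 0 * X 2 + X 2 ^ 3) ^ 2 + (X 0 ^ 4 + X 1 ^ 6 + X 1 ^ 4 * X 2 ^ 3) := by ring
  have hP0 : ((X 0 * X 2 + X 2 ^ 3) ^ 2 : MvPolynomial (Fin 3) k) ≠ 0 := ne_zero_of_eval_ne_zero ![(0 : k), 0, 1] (by simp)
  have hQ : eval ![(-1 : k), 1, 1] ((X 0 * X 2 + X 2 ^ 3) : MvPolynomial (Fin 3) k) = 0 := by simp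
  exact not_isLocallyNewtonNondegenerate_of_split ![(2 : ℤ), 2, 1] (by decide) hF hP hR hP0 ![(-1 : k), 1, 1]
    (fun i => by fin_cases i <;> simp) (by rw [map_pow, hQ]; norm_num) (fun i => eval_pderiv_sq_eq_zero _ _ hQ i)

end Summit.ResolutionOfSingularities.ResolutionOfSingularities.Cruxes.EquisingularLiftNat.Sections

end
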